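import Literature.NumberTheory.GaloisRepresentations.AbsolutelyIrreducibleReduction
import Literature.NumberTheory.GaloisRepresentations.ResidualGaloisRep
import Literature.RepresentationTheory.Semisimple.BurnsideMatrixSpan
import HarnessLib

/-!
# Burnside form = residually absolutely irreducible

Bridge between the two formalisations of "`ρ̄` is absolutely irreducible" for a framed
representation `ρ : Γ →ₜ* GL_n(K)` over a non-archimedean normed field `K` with valuation ring
`O = {‖x‖ ≤ 1}`:

* the norm-only **Burnside form** `FramedRep.HasAbsolutelyIrreducibleReduction ρ`
  (`AbsolutelyIrreducibleReduction.lean`; verbatim the clause inlined in route `GSpinRung`), and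
* `IsResiduallyAbsIrreducible O ↑ρ` (`ResidualGaloisRep.lean`): some reduction
  `ρ̄ : Γ → GL_n(O/𝔪)` of `ρ` is absolutely irreducible (irreducible after every extension of
  scalars, `IsAbsIrreducible`).

`FramedRep.hasAbsolutelyIrreducibleReduction_iff_isResiduallyAbsIrreducible`: for `n ≥ 1` the two
agree — by `hasAbsolutelyIrreducibleReduction_iff_exists_span_eq_top` (Burnside form ⟺ some
integral model has residual image spanning `M_n(O/𝔪)`) and Burnside's theorem in the form
`Literature.RepresentationTheory.Semisimple.span_eq_top_iff_forall_isIrreducible` (spanning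
`M_n` ⟺ absolutely irreducible, over any field), plus invariance of spanning under conjugation.
The `ℚ̄_p` case `FramedGaloisRep.hasAbsolutelyIrreducibleReduction_iff_isResiduallyAbsIrreducible`
(`O = ℤ̄_p = padicAlgClIntegers p`) needs no hypothesis besides `n ≥ 1`.  (For `n = 0` the
Burnside form holds vacuously while the zero representation is not irreducible.)

## References

* C. W. Curtis, I. Reiner, *Representation theory of finite groups and associative algebras*
  (1962), (27.4), (29.13).
* H. Darmon, F. Diamond, R. Taylor, *Fermat's Last Theorem* (1995), §2.1.
-/

noncomputable section

open scoped MatrixGroups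

open Matrix IsLocalRing Literature.RepresentationTheory.Semisimple

namespace Literature.NumberTheory.GaloisRepresentations

/-! ### Spanning `M_n` is invariant under conjugation -/

/-- Conjugating a family of matrices by an invertible matrix does not change whether it spans
`M_n(k)` (`X ↦ A X B` is a linear automorphism of `M_n(k)` for `A, B` invertible). [folklore] -/
theorem span_range_units_conj_eq_top_iff {k : Type*} [Field k] {n : ℕ} {ι : Type*}
    (Q : GL (Fin n) k) (X : ι → Matrix (Fin n) (Fin n) k) :
    Submodule.span k (Set.range fun i =>
      ((Q⁻¹ : GL (Fin n) k) : Matrix (Fin n) (Fin n) k) * X i * (Q : Matrix (Fin n) (Fin n) k)) = ⊤ ↔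
      Submodule.span k (Set.range X) = ⊤ := by
  -- the linear automorphism `M ↦ A M B` of `M_n(k)` for units `A, B`
  have key : ∀ (A B : GL (Fin n) k) (Y : ι → Matrix (Fin n) (Fin n) k),
      Submodule.span k (Set.range Y) = ⊤ →
        Submodule.span k (Set.range fun i =>
          (A : Matrix (Fin n) (Fin n) k) * Y i * (B : Matrix (Fin n) (Fin n) k)) = ⊤ := by
    intro A B Y hY
    let L : Matrix (Fin n) (Fin n) k →ₗ[k] Matrix (Fin n) (Fin n) k :=
      (LinearMap.mulLeft k (A : Matrix (Fin n) (Fin n) k)).comp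
        (LinearMap.mulRight k (B : Matrix (Fin n) (Fin n) k))
    have hL : ∀ M, L M = (A : Matrix (Fin n) (Fin n) k) * M * (B : Matrix (Fin n) (Fin n) k) :=
      fun M => by simp [L, mul_assoc]
    have hsurj : Function.Surjective L := fun N =>
      ⟨((A⁻¹ : GL (Fin n) k) : Matrix (Fin n) (Fin n) k) * N *
          ((B⁻¹ : GL (Fin n) k) : Matrix (Fin n) (Fin n) k), by
        rw [hL, ← mul_assoc, ← mul_assoc, ← Units.val_mul, mul_inv_cancel, Units.val_one,
          one_mul, mul_assoc, ← Units.val_mul, inv_mul_cancel, Units.val_one, mul_one]⟩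
    have hrange : (Set.range fun i =>
        (A : Matrix (Fin n) (Fin n) k) * Y i * (B : Matrix (Fin n) (Fin n) k)) = L '' Set.range Y := by
      rw [← Set.range_comp]
      exact congrArg Set.range (funext fun i => (hL (Y i)).symm)
    rw [hrange, Submodule.span_image, hY, Submodule.map_top, LinearMap.range_eq_top]
    exact hsurj
  constructor
  · intro h
    have h' := key Q Q⁻¹ _ h
    simp only [← mul_assoc, ← Units.val_mul, mul_inv_cancel, Units.val_one, one_mul] at h'
    simp only [mul_assoc, ← Units.val_mul, mul_inv_cancel, Units.val_one, mul_one] at h'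
    exact h'
  · exact key Q⁻¹ Q X

/-! ### The bridge -/

namespace FramedRep

variable {Γ : Type*} [Group Γ] [TopologicalSpace Γ] {K : Type*} [NormedField K]
  {O : ValuationSubring K} {n : ℕ}

omit [TopologicalSpace Γ] in
/-- The reduction along the identity residue embedding is the plain reduction `ρ₀ mod 𝔪`. [folklore] -/
lemma integralReduction_id_apply (ρ₀ : Γ →* GL (Fin n) O) (g : Γ) :
    integralReduction (RingHom.id (ResidueField O)) ρ₀ g =
      (Matrix.GeneralLinearGroup.map (residue O)).comp ρ₀ g := by
  rw [integralReduction, RingHom.id_comp]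

/-- **Burnside form ⟺ residually absolutely irreducible.** For `O = {‖x‖ ≤ 1} ⊆ K` and `n ≥ 1`,
a framed representation `ρ : Γ → GL_n(K)` has absolutely irreducible reduction in the Burnside
form (an integral frame and `n²` group elements whose images have unit `n² × n²` determinant)
iff some reduction `ρ̄ : Γ → GL_n(O/𝔪)` of `ρ` is absolutely irreducible
(`IsResiduallyAbsIrreducible`): both say that some integral model has residual image spanning
`M_n(O/𝔪)` (`hasAbsolutelyIrreducibleReduction_iff_exists_span_eq_top`; Burnside,
`span_eq_top_iff_forall_isIrreducible`; conjugation invariance of spanning).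
(Curtis–Reiner (27.4), (29.13).) [folklore] -/
theorem hasAbsolutelyIrreducibleReduction_iff_isResiduallyAbsIrreducible
    (hO : ∀ x : K, x ∈ O ↔ ‖x‖ ≤ 1) (hn : 0 < n) (ρ : FramedRep Γ K n) :
    ρ.HasAbsolutelyIrreducibleReduction ↔ IsResiduallyAbsIrreducible O (ρ : Γ →* GL (Fin n) K) := by
  rw [hasAbsolutelyIrreducibleReduction_iff_exists_span_eq_top hO]
  constructor
  · rintro ⟨P, ρ₀, hP, hspan⟩
    refine ⟨(Matrix.GeneralLinearGroup.map (residue O)).comp ρ₀, ⟨ρ₀, 1, ⟨P, fun g => hP g⟩,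
      fun g => ?_⟩, ?_⟩
    · rw [integralReduction_id_apply, inv_one, one_mul, mul_one]
    · exact (span_eq_top_iff_forall_isIrreducible hn _).1 hspan
  · rintro ⟨τ, ⟨ρ₀, Q, ⟨P, hP⟩, hτ⟩, habs⟩
    refine ⟨P, ρ₀, fun g => hP g, ?_⟩
    have hspanτ := (span_eq_top_iff_forall_isIrreducible hn τ).2 habs
    have hred : ∀ g, (Matrix.GeneralLinearGroup.map (residue O)).comp ρ₀ g = Q⁻¹ * τ g * Q := by
      intro g
      rw [← integralReduction_id_apply, hτ g]
      group
    have hcoe : (fun g => (((Matrix.GeneralLinearGroup.map (residue O)).comp ρ₀ g :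
        GL (Fin n) (ResidueField O)) : Matrix (Fin n) (Fin n) (ResidueField O))) =
        fun g => ((Q⁻¹ : GL (Fin n) (ResidueField O)) : Matrix (Fin n) (Fin n) (ResidueField O)) *
          ((τ g : GL (Fin n) (ResidueField O)) : Matrix (Fin n) (Fin n) (ResidueField O)) *
          (Q : Matrix (Fin n) (Fin n) (ResidueField O)) := by
      funext g
      rw [hred g, Units.val_mul, Units.val_mul]
    rw [hcoe, span_range_units_conj_eq_top_iff]
    exact hspanτ

end FramedRep

/-! ### The `ℚ̄_p` case -/

namespace FramedGaloisRep

variable {p : ℕ} [Fact p.Prime] {F : Type*} [Field F] {n : ℕ}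

/-- For `ρ : Γ_F → GL_n(ℚ̄_p)` with `n ≥ 1`: the Burnside form
`FramedRep.HasAbsolutelyIrreducibleReduction ρ` (route `GSpinRung`) is equivalent to
`ρ.IsResiduallyAbsIrreducible` (`ResidualGaloisRep.lean`, `O = ℤ̄_p`): "`ρ̄` is absolutely
irreducible". [folklore] -/
theorem hasAbsolutelyIrreducibleReduction_iff_isResiduallyAbsIrreducible (hn : 0 < n)
    (ρ : FramedGaloisRep F (PadicAlgCl p) n) :
    FramedRep.HasAbsolutelyIrreducibleReduction ρ ↔ ρ.IsResiduallyAbsIrreducible :=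
  FramedRep.hasAbsolutelyIrreducibleReduction_iff_isResiduallyAbsIrreducible
    (padicAlgCl_mem_valuationSubring_iff p) hn ρ

end FramedGaloisRep

end Literature.NumberTheory.GaloisRepresentations
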